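import Mathlib
import Summits.NavierStokesRegularity.FluidComputer.TransportGalerkinSmooth
import Summits.NavierStokesRegularity.FluidComputer.TransportGalerkinUnique
import HarnessLib

/-!
# Galerkin limit of the transport model, XXII: THE solution is unique among ALL spatially smooth classical solutions (instab g20, cell `ns-blowup`, 2026-08-27)

HONEST FRAMING (human ruling D-0035): nothing here is a claim about Navier–Stokes blow-up.
WHAT THIS IS NOT: not NS — a MODEL theorem schema (perturbation equation about a smooth host on
`𝕋^d` in the scaled phase space `E = lp (ℤ^d → V) 2`). No number or census word moves.

PURPOSE. Composition of parts XVII (`TransportGalerkinExistence.exists_solution_of_levelBound`: THE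
solution exists as the uniform limit of the levels, in the order-`(d+3)` tail class), XIX
(`TransportGalerkinSmooth.smooth_of_tendstoUniformlyOn`: it is smooth in space with uniform tails of
every order) and XXI (`TransportGalerkinUnique.eqOn_of_smooth_solutions`: weak–strong uniqueness in
`L²` against a reference with bounded unscaled first moment). Results, under the level hypotheses of
part XVII (host `ν > 0`; rapidly decreasing constrained seed `z`; levels at `cubeProj (n + K)` on
`[0, T]` as `C¹` solutions of the Galerkin ODE keeping the clauses with ONE `E`-bound):

* `weightOne_unscale_le_of_tail` — a uniform polynomial tail of scaled order `d + 3` bounds the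
  unscaled first moment `A₁(Λ⁻² ⇑x) ≤ ∑⟨l⟩ρ_l` (`TransportGalerkinRapid.weightThree_unscale_le`);
* `tendstoUniformlyOn_of_smooth_solution` — EVERY classical solution on `[0, T]` from `z` whose values
  on `(0, T)` are rapidly decreasing and keep the three clauses (no uniformity in `t`) is the uniform
  limit of the levels;
* `eqOn_of_smooth_solutions_of_levelBound` — two such solutions agree on `[0, T]`.

So the R-β words are statements about THE solution in the widest class in which the lattice equation
is literal: spatially smooth classical solutions. General finite `d`, Hilbert proper `V`; Mathlib +
the tree files cited; no new definitions.
-/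

noncomputable section

open scoped ENNReal NNReal ComplexConjugate InnerProductSpace
open Set Filter Topology

namespace Summit.NavierStokesRegularity.FluidComputer.TransportGalerkinUniqueLimit

open RCLike
open Literature.Analysis.FunctionSpaces Literature.Analysis.FunctionSpaces.Lattice
open Literature.Analysis.FunctionSpaces.Torus
open Literature.Analysis.ODE
open Summit.NavierStokesRegularity.FluidComputer.GalerkinLatticePhaseSpace
open Summit.NavierStokesRegularity.FluidComputer.TransportGalerkin
open Summit.NavierStokesRegularity.FluidComputer.TransportGalerkinRapid
open Summit.NavierStokesRegularity.FluidComputer.TransportGalerkinBox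
open Summit.NavierStokesRegularity.FluidComputer.TransportGalerkinResidenceBox
open Summit.NavierStokesRegularity.FluidComputer.TransportGalerkinExistence
open Summit.NavierStokesRegularity.FluidComputer.TransportGalerkinSmooth
open Summit.NavierStokesRegularity.FluidComputer.TransportGalerkinUnique

variable {d : Type*} [Fintype d] [DecidableEq d]
variable {V : Type*} [NormedAddCommGroup V] [InnerProductSpace ℂ V] [CompleteSpace V] [ProperSpace V]
variable {ν : ℝ} {Uv : (d → ℤ) → V} {π : d → (V →L[ℂ] ℂ)} {P : (d → ℤ) → (V →L[ℂ] V)}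

/-! ## §0 Two uniform limits agree -/

omit [Fintype d] [DecidableEq d] in
/-- Two uniform limits of one family on a set agree there (Hausdorff codomain). -/
theorem eqOn_of_two_uniform_limits {α β ι : Type*} [UniformSpace β] [T2Space β] {F : ι → α → β}
    {f g : α → β} {p : Filter ι} [p.NeBot] {s : Set α} (hf : TendstoUniformlyOn F f p s)
    (hg : TendstoUniformlyOn F g p s) : EqOn f g s :=
  fun _ hx => tendsto_nhds_unique (hf.tendsto_at hx) (hg.tendsto_at hx)

/-! ## §1 A polynomial tail bounds the unscaled first moment -/

omit [DecidableEq d] [CompleteSpace V] [ProperSpace V] in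
/-- **`A₁(Λ⁻² ⇑x) ≤ ∑⟨l⟩ρ_l` on the box** (first moment of the unscaled family of a box element with
summable `⟨l⟩ρ_l`; from `TransportGalerkinRapid.weightThree_unscale_le` and `⟨l⟩ ≤ ⟨l⟩³`). -/
theorem weightOne_unscale_le_of_tail {ρ : (d → ℤ) → ℝ} (hρ0 : ∀ k, 0 ≤ ρ k)
    (hρ1 : Summable fun k => sobolevWeight 1 k * ρ k) {x : lp (fun _ : (d → ℤ) => V) 2}
    (hx : x ∈ box ρ π P) :
    (∑' l, ENNReal.ofReal (sobolevWeight 1 l) * ‖wmul (-2) (⇑x) l‖ₑ).toReal ≤ ∑' l, sobolevWeight 1 l * ρ l := by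
  have h3 := weightThree_unscale_le hρ0 hρ1 hx
  have h1 : ∑' l, ENNReal.ofReal (sobolevWeight 1 l) * ‖wmul (-2) (⇑x) l‖ₑ ≤
      ∑' l, ENNReal.ofReal (sobolevWeight 3 l) * ‖wmul (-2) (⇑x) l‖ₑ :=
    ENNReal.tsum_le_tsum fun l => mul_le_mul'
      (ENNReal.ofReal_le_ofReal (sobolevWeight_mono (by norm_num : (1 : ℝ) ≤ 3) l)) le_rfl
  exact ENNReal.toReal_le_of_le_ofReal (tsum_nonneg fun l => mul_nonneg (sobolevWeight_pos _ _).le (hρ0 l))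
    (h1.trans h3)

/-! ## §2 Every spatially smooth classical solution is the limit of the levels -/

/-- **Every spatially smooth classical solution from the seed is the uniform limit of the levels**
(`tendstoUniformlyOn_of_smooth_solution`). Level hypotheses as in
`TransportGalerkinExistence.exists_solution_of_levelBound`; the solution `w₂`: continuous on `[0, T]`,
`w₂ 0 = z`, `w₂' = F(w₂)` on `(0, T)`, and for `t ∈ (0, T)` the value `⇑(w₂ t)` is rapidly decreasing,
`P`-fixed, real and divergence-free through `π`. No tail uniformity in `t` is asked. -/
theorem tendstoUniformlyOn_of_smooth_solution (K : ℕ) (hν : 0 < ν) (hUv : RapidDecay Uv)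
    (hUreal : ∀ j p, π j (Uv (-p)) = conj (π j (Uv p)))
    (hUdiv : ∑ j, freqDeriv j (fun p => π j (Uv p)) = 0) (hπ : ∀ j, ‖π j‖ ≤ 1)
    (hPsa : ∀ k, IsSelfAdjoint (P k)) (hPn : ∀ k, ‖P k‖ ≤ 1)
    (hσ : ∑' l : d → ℤ, ENNReal.ofReal (sobolevWeight (-2) l ^ 2) < ∞)
    {T : ℝ} (hT : 0 ≤ T)
    {z : lp (fun _ : (d → ℤ) => V) 2} (hzr : RapidDecay (⇑z))
    (hzfix : ∀ k, P k (z k) = z k) (hzreal : ∀ j k, π j (z (-k)) = conj (π j (z k)))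
    (hzdiv : ∀ k, ∑ j, ((k j : ℤ) : ℂ) * π j (z k) = 0)
    {u : ℕ → ℝ → lp (fun _ : (d → ℤ) => V) 2} {r : ℝ} (hr : 0 < r)
    (sol_continuousOn : ∀ n, ContinuousOn (u n) (Icc 0 T))
    (sol_init : ∀ n, u n 0 = cubeProj (n + K) z)
    (sol_hasDerivWithinAt : ∀ n, ∀ t ∈ Icc 0 T,
      HasDerivWithinAt (u n) (cubeProj (n + K) (nsField ν Uv π P (u n t))) (Icc 0 T) t)
    (sol_proj : ∀ n, ∀ t ∈ Icc 0 T, cubeProj (n + K) (u n t) = u n t)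
    (sol_fix : ∀ n, ∀ t ∈ Icc 0 T, ∀ k, P k ((u n t : (d → ℤ) → V) k) = (u n t : (d → ℤ) → V) k)
    (sol_real : ∀ n, ∀ t ∈ Icc 0 T, ∀ j k,
      π j ((u n t : (d → ℤ) → V) (-k)) = conj (π j ((u n t : (d → ℤ) → V) k)))
    (sol_div : ∀ n, ∀ t ∈ Icc 0 T, ∀ k, ∑ j, ((k j : ℤ) : ℂ) * π j ((u n t : (d → ℤ) → V) k) = 0)
    (sol_bound : ∀ n, ∀ t ∈ Icc 0 T, ‖u n t‖ ≤ r)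
    {w₂ : ℝ → lp (fun _ : (d → ℤ) => V) 2} (hw₂ : ContinuousOn w₂ (Icc 0 T)) (hw₂0 : w₂ 0 = z)
    (hw₂' : ∀ t ∈ Ioo 0 T, HasDerivAt w₂ (nsField ν Uv π P (w₂ t)) t)
    (hr₂ : ∀ t ∈ Ioo 0 T, RapidDecay (⇑(w₂ t)))
    (hfix₂ : ∀ t ∈ Ioo 0 T, ∀ k, P k ((w₂ t : (d → ℤ) → V) k) = (w₂ t : (d → ℤ) → V) k)
    (hreal₂ : ∀ t ∈ Ioo 0 T, ∀ j k, π j ((w₂ t : (d → ℤ) → V) (-k)) = conj (π j ((w₂ t : (d → ℤ) → V) k)))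
    (hdiv₂ : ∀ t ∈ Ioo 0 T, ∀ k, ∑ j, ((k j : ℤ) : ℂ) * π j ((w₂ t : (d → ℤ) → V) k) = 0) :
    TendstoUniformlyOn (fun n t => u n t) w₂ atTop (Icc 0 T) := by
  -- THE solution (the uniform limit) and its properties
  obtain ⟨w, hconv, hw, hw0, hw', ⟨Cw, hCw, hwdec⟩, hwfix, hwreal, hwdiv⟩ :=
    exists_solution_of_levelBound K hν hUv hUreal hUdiv hπ hPsa hPn hσ hT hzr hzfix hzreal hzdiv hr
      sol_continuousOn sol_init sol_hasDerivWithinAt sol_proj sol_fix sol_real sol_div sol_bound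
  have hsmooth := (smooth_of_tendstoUniformlyOn K hν hUv hUreal hUdiv hπ hPsa hPn hσ hzr hr sol_continuousOn
    sol_init sol_hasDerivWithinAt sol_proj sol_fix sol_real sol_div sol_bound hconv).2
  -- the reference's unscaled first moment is bounded on the window
  set ρ : (d → ℤ) → ℝ := fun k => Cw * sobolevWeight (-((Fintype.card d : ℝ) + 3)) k with hρ
  have hρ0 : ∀ k, 0 ≤ ρ k := fun k => mul_nonneg hCw (sobolevWeight_pos _ _).le
  have hρ1 := (summable_radii (d := d) Cw).1
  have hA : ∀ t ∈ Ioo 0 T,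
      (∑' l, ENNReal.ofReal (sobolevWeight 1 l) * ‖wmul (-2) (⇑(w t)) l‖ₑ).toReal ≤ ∑' l, sobolevWeight 1 l * ρ l :=
    fun t ht => weightOne_unscale_le_of_tail hρ0 hρ1 (mem_box.2 ⟨hwdec t (Ioo_subset_Icc_self ht),
      hwfix t (Ioo_subset_Icc_self ht), hwreal t (Ioo_subset_Icc_self ht), hwdiv t (Ioo_subset_Icc_self ht)⟩)
  -- weak–strong uniqueness
  have heq : EqOn w w₂ (Icc 0 T) :=
    eqOn_of_smooth_solutions hν.le hUv hπ hUreal hUdiv hPsa hPn hw hw₂ (hw0.trans hw₂0.symm) hw' hw₂'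
      (fun t ht => hsmooth t (Ioo_subset_Icc_self ht)) hr₂
      (fun t ht => hwfix t (Ioo_subset_Icc_self ht)) hfix₂
      (fun t ht => hwreal t (Ioo_subset_Icc_self ht)) hreal₂
      (fun t ht => hwdiv t (Ioo_subset_Icc_self ht)) hdiv₂ hA
  exact hconv.congr_right heq

/-- **UNIQUENESS OF THE SOLUTION AMONG SPATIALLY SMOOTH CLASSICAL SOLUTIONS**
(`eqOn_of_smooth_solutions_of_levelBound`): under the level hypotheses, two classical solutions on
`[0, T]` from the seed `z` whose values on `(0, T)` are rapidly decreasing and keep the three clauses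
agree on `[0, T]` (both are the uniform limit of the levels). -/
theorem eqOn_of_smooth_solutions_of_levelBound (K : ℕ) (hν : 0 < ν) (hUv : RapidDecay Uv)
    (hUreal : ∀ j p, π j (Uv (-p)) = conj (π j (Uv p)))
    (hUdiv : ∑ j, freqDeriv j (fun p => π j (Uv p)) = 0) (hπ : ∀ j, ‖π j‖ ≤ 1)
    (hPsa : ∀ k, IsSelfAdjoint (P k)) (hPn : ∀ k, ‖P k‖ ≤ 1)
    (hσ : ∑' l : d → ℤ, ENNReal.ofReal (sobolevWeight (-2) l ^ 2) < ∞)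
    {T : ℝ} (hT : 0 ≤ T)
    {z : lp (fun _ : (d → ℤ) => V) 2} (hzr : RapidDecay (⇑z))
    (hzfix : ∀ k, P k (z k) = z k) (hzreal : ∀ j k, π j (z (-k)) = conj (π j (z k)))
    (hzdiv : ∀ k, ∑ j, ((k j : ℤ) : ℂ) * π j (z k) = 0)
    {u : ℕ → ℝ → lp (fun _ : (d → ℤ) => V) 2} {r : ℝ} (hr : 0 < r)
    (sol_continuousOn : ∀ n, ContinuousOn (u n) (Icc 0 T))
    (sol_init : ∀ n, u n 0 = cubeProj (n + K) z)
    (sol_hasDerivWithinAt : ∀ n, ∀ t ∈ Icc 0 T,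
      HasDerivWithinAt (u n) (cubeProj (n + K) (nsField ν Uv π P (u n t))) (Icc 0 T) t)
    (sol_proj : ∀ n, ∀ t ∈ Icc 0 T, cubeProj (n + K) (u n t) = u n t)
    (sol_fix : ∀ n, ∀ t ∈ Icc 0 T, ∀ k, P k ((u n t : (d → ℤ) → V) k) = (u n t : (d → ℤ) → V) k)
    (sol_real : ∀ n, ∀ t ∈ Icc 0 T, ∀ j k,
      π j ((u n t : (d → ℤ) → V) (-k)) = conj (π j ((u n t : (d → ℤ) → V) k)))
    (sol_div : ∀ n, ∀ t ∈ Icc 0 T, ∀ k, ∑ j, ((k j : ℤ) : ℂ) * π j ((u n t : (d → ℤ) → V) k) = 0)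
    (sol_bound : ∀ n, ∀ t ∈ Icc 0 T, ‖u n t‖ ≤ r)
    {w₁ : ℝ → lp (fun _ : (d → ℤ) => V) 2} (hw₁ : ContinuousOn w₁ (Icc 0 T)) (hw₁0 : w₁ 0 = z)
    (hw₁' : ∀ t ∈ Ioo 0 T, HasDerivAt w₁ (nsField ν Uv π P (w₁ t)) t)
    (hr₁ : ∀ t ∈ Ioo 0 T, RapidDecay (⇑(w₁ t)))
    (hfix₁ : ∀ t ∈ Ioo 0 T, ∀ k, P k ((w₁ t : (d → ℤ) → V) k) = (w₁ t : (d → ℤ) → V) k)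
    (hreal₁ : ∀ t ∈ Ioo 0 T, ∀ j k, π j ((w₁ t : (d → ℤ) → V) (-k)) = conj (π j ((w₁ t : (d → ℤ) → V) k)))
    (hdiv₁ : ∀ t ∈ Ioo 0 T, ∀ k, ∑ j, ((k j : ℤ) : ℂ) * π j ((w₁ t : (d → ℤ) → V) k) = 0)
    {w₂ : ℝ → lp (fun _ : (d → ℤ) => V) 2} (hw₂ : ContinuousOn w₂ (Icc 0 T)) (hw₂0 : w₂ 0 = z)
    (hw₂' : ∀ t ∈ Ioo 0 T, HasDerivAt w₂ (nsField ν Uv π P (w₂ t)) t)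
    (hr₂ : ∀ t ∈ Ioo 0 T, RapidDecay (⇑(w₂ t)))
    (hfix₂ : ∀ t ∈ Ioo 0 T, ∀ k, P k ((w₂ t : (d → ℤ) → V) k) = (w₂ t : (d → ℤ) → V) k)
    (hreal₂ : ∀ t ∈ Ioo 0 T, ∀ j k, π j ((w₂ t : (d → ℤ) → V) (-k)) = conj (π j ((w₂ t : (d → ℤ) → V) k)))
    (hdiv₂ : ∀ t ∈ Ioo 0 T, ∀ k, ∑ j, ((k j : ℤ) : ℂ) * π j ((w₂ t : (d → ℤ) → V) k) = 0) :
    EqOn w₁ w₂ (Icc 0 T) := by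
  have h₁ := tendstoUniformlyOn_of_smooth_solution K hν hUv hUreal hUdiv hπ hPsa hPn hσ hT hzr hzfix hzreal hzdiv
    hr sol_continuousOn sol_init sol_hasDerivWithinAt sol_proj sol_fix sol_real sol_div sol_bound hw₁ hw₁0 hw₁'
    hr₁ hfix₁ hreal₁ hdiv₁
  have h₂ := tendstoUniformlyOn_of_smooth_solution K hν hUv hUreal hUdiv hπ hPsa hPn hσ hT hzr hzfix hzreal hzdiv
    hr sol_continuousOn sol_init sol_hasDerivWithinAt sol_proj sol_fix sol_real sol_div sol_bound hw₂ hw₂0 hw₂'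
    hr₂ hfix₂ hreal₂ hdiv₂
  exact eqOn_of_two_uniform_limits h₁ h₂

end Summit.NavierStokesRegularity.FluidComputer.TransportGalerkinUniqueLimit

end
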